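import Summits.NavierStokesRegularity.NavierStokesRegularity.Theorems.CoriolisHeadLocalEnergyDriftPressure
import Summits.NavierStokesRegularity.NavierStokesRegularity.Theorems.CoriolisHeadFarFieldCovariance
import Summits.NavierStokesRegularity.NavierStokesRegularity.Theorems.CoriolisHeadFarFieldLimitTools
import Literature.Analysis.PDE.HarmonicSmoothLiouville
import HarnessLib
/-!
# CoriolisHeadLocalEnergyDriftNormalForm — crux `NoCoRotatingCore` (stmt-NavierStokesRegularity-22676), line
# `local_energy_rescue` (crux workfile, ns-idea-10 g3), stub S1 `stub_driftNormalForm`: **S1 REDUCED to the existence of a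
# `BMO₂` Riesz pressure** (seat ns-ffc-k1 g2, helper)

S1 asks: a bounded smooth rotated profile `(U, P)` can be recentred, `W = U(· + y₀) − b`, so that the recentred pressure
has bounded mean oscillation `∫_{B(z,ρ)}(P' − m)² ≤ Kρ³`.  The printed source (KNSS 2009 §5 / Seregin 2014 L.6.5, Thm 2.6)
is the pressure normal form `P = −RᵢRⱼ(UᵢUⱼ) + ℓ·y + c`, whose Lean cost is the Calderón–Zygmund bound
`RᵢRⱼ : L^∞ → BMO` (not in the tree).  This file proves EVERYTHING ELSE:

`driftNormalForm_of_rieszPressure`: if there is a smooth `N` with the same Laplacian as `P` (`ΔN = ΔP = −tr(DU∘DU)`)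
and bounded mean oscillation `∫_{B(z,ρ)}(N − m)² ≤ K_N ρ³` (all balls), then S1's conclusion holds (verbatim shape, with the
skeleton's `E3` spelled out).  So S1 ⟸ «the Riesz pressure `RᵢRⱼ(UᵢUⱼ)` of a bounded smooth field exists as a smooth `BMO₂`
solution of `ΔN = ∂ᵢ∂ⱼ(UᵢUⱼ)`» — a pure harmonic-analysis fact about bounded fields, independent of the profile equation.

PROOF (critic idea-crit-8's V31 P3 route).  `H := P − N` is harmonic, hence smooth; its gradient is a harmonic map.  It is
BOUNDED: by the mean-value formula `∂ₑH(x₀) = ∫ ∂ₑχ_R(z) H(x₀ − z) dz` (tree `fderiv_harmonic_eq_integral_probeBump`, unit-mass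
radial bumps `χ_R` at scale `R = max(‖x₀‖, 1)`): the `N`-part is `O(K_N^{1/2}/R)` by `∫∂ₑχ_R = 0` and `BMO₂`; the `P`-part is
`∫ χ_R(z) ∂ₑP(x₀ − z) dz` (integration by parts), and the profile equation gives `∂ₑP = ⟪νΔU − aU − BU − DU[U], e⟫ − DU[V]·e`
with `V(y) = ay − By`: the first group is bounded pointwise (KNSS derivative bounds, tree
`exists_norm_iteratedFDeriv_le_of_rotatedProfile`), and the DRIFT term integrates by parts onto the bump,
`∫ ψ Df(V) = −∫ f Dψ(V) − 3a∫ψf` (`div V = 3a`, `B` skew), where `|V| ≤ (a + ‖B‖)(‖x₀‖ + 2R) ≤ 3(a + ‖B‖)R` on the support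
and `‖Dψ‖ ≲ R⁻⁴` on a ball of volume `∼ R³` — bounded exactly because the bump is taken AT SCALE `‖x₀‖`.  Liouville
(`isConst_of_harmonic_bounded_inner`) makes `∇H ≡ ℓ` constant, `H = ⟪ℓ, ·⟫ + c`; recentring with `(aI + B)b = −ℓ`,
`ay₀ − By₀ = −b` (tree `exists_add_clm_apply_eq_of_skew`, `exists_recentre`) gives the recentred system (the algebra of the
landed `farField_translationCovariance`) with pressure `P'(y) = P(y + y₀) + ⟪ab + Bb, y⟫ = N(y + y₀) + const`, which is `BMO₂`.

HONEST FRAMING.  Helper for an UNREGISTERED line; S1 itself stays open (modulo the Riesz-pressure fact); nothing here proves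
`NoCoRotatingCore`, Pineau–Vicol's Conjecture 1.1 or NS regularity.

References: G. Koch, N. Nadirashvili, G. Seregin, V. Šverák, Acta Math. 203 (2009), §5; G. Seregin, *Lecture notes on
regularity theory for the Navier–Stokes equations* (2014), Lemma 6.5, Thm 2.6, Remark 6.3 [Seregin2014]; D. Gilbarg,
N. Trudinger, *Elliptic PDE of second order*, Thm 2.1, Thm 2.10 [GilbargTrudinger2001]; line card
`Cruxes/NoCoRotatingCore/Lines/local_energy_rescue.md` (S1, critic V31 P3).
-/

noncomputable section

open MeasureTheory Set Function Filter Topology Metric InnerProductSpace Real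
open scoped RealInnerProductSpace Laplacian ContDiff Topology

-- the summit and its single sub-problem share the name (CONVENTIONS §1), as in every Theorems file
set_option linter.dupNamespace false

namespace Summit.NavierStokesRegularity.NavierStokesRegularity.Theorems.CoriolisHead

namespace LocalEnergyRescue

open Literature.Analysis.FluidPDE

/-! ## §5 The harmonic part `H = P − N` has bounded gradient, hence is affine -/

section Affine

variable {ν a : ℝ} {B : EuclideanSpace ℝ (Fin 3) →L[ℝ] EuclideanSpace ℝ (Fin 3)}
  {U : EuclideanSpace ℝ (Fin 3) → EuclideanSpace ℝ (Fin 3)} {P : EuclideanSpace ℝ (Fin 3) → ℝ}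

/-- **The harmonic part of the pressure is affine.**  If `N` is smooth with `ΔN = ΔP` and bounded mean oscillation, then
`P − N = ⟪ℓ, ·⟫ + c` for some `ℓ, c`: `H = P − N` is harmonic, `∇H` is bounded by the probe estimates of §3–§4 at scale
`R = max(‖x₀‖, 1)`, hence (Liouville for the harmonic map `∇H`) constant. [cite: GilbargTrudinger2001, Thm 2.10] -/
theorem exists_affine_of_rieszPressure (hν : 0 < ν) (ha : 0 < a)
    (hU : ContDiff ℝ ∞ U) (hP : ContDiff ℝ 2 P) (hB : ∀ x, inner ℝ (B x) x = 0) (hdiv : VectorCalculus.IsDivFree U)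
    (heq : ∀ y, -(ν • (Δ U) y) + a • U y + a • fderiv ℝ U y y + (B (U y) - fderiv ℝ U y (B y)) +
      convect U U y + gradient P y = 0)
    {M : ℝ} (hM : ∀ y, ‖U y‖ ≤ M) {N : EuclideanSpace ℝ (Fin 3) → ℝ} (hN : ContDiff ℝ ∞ N)
    (hΔN : ∀ y, (Δ N) y = (Δ P) y) {K : ℝ}
    (hK : ∀ (z : EuclideanSpace ℝ (Fin 3)) (ρ : ℝ), 0 < ρ → ∃ m : ℝ, ∫ y in ball z ρ, (N y - m) ^ 2 ≤ K * ρ ^ 3) :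
    ∃ (ℓ : EuclideanSpace ℝ (Fin 3)) (c : ℝ), ∀ y, P y = N y + (⟪ℓ, y⟫ + c) := by
  haveI : Nontrivial (EuclideanSpace ℝ (Fin 3)) := inferInstance
  have hP1 : ContDiff ℝ 1 P := hP.of_le (by norm_num)
  have hPs : ContDiff ℝ ∞ P := contDiff_pressure_of_rotated hU hP1 heq
  -- the harmonic part
  set H : EuclideanSpace ℝ (Fin 3) → ℝ := fun y => P y - N y with hH
  have hHs : ContDiff ℝ ∞ H := hPs.sub hN
  have hH2 : ContDiff ℝ 2 H := hHs.of_le (by norm_cast)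
  have hH3 : ContDiff ℝ 3 H := hHs.of_le (by norm_cast)
  have hΔH : Δ H = 0 := by
    funext y
    have h := (hPs.of_le (by norm_cast : (2 : ℕ∞ω) ≤ ∞)).contDiffAt.laplacian_sub
      ((hN.of_le (by norm_cast : (2 : ℕ∞ω) ≤ ∞)).contDiffAt (x := y))
    have e : H = P - N := rfl
    rw [e, h, hΔN y, sub_self]
    rfl
  have hHarm : HarmonicOnNhd H univ := fun z _ => ⟨hH2.contDiffAt, by rw [hΔH]⟩
  -- the gradient bound
  obtain ⟨CP, hCP0, hCP⟩ := exists_bound_integral_probeBump_fderiv_pressure hν ha hU hP hB hdiv heq hM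
  obtain ⟨CN, hCN0, hCN⟩ := exists_bound_integral_fderiv_probeBump_bmo hN.continuous hK
  have hgrad : ∀ x₀ e : EuclideanSpace ℝ (Fin 3), |fderiv ℝ H x₀ e| ≤ (CP + CN) * ‖e‖ := by
    intro x₀ e
    set R : ℝ := max ‖x₀‖ 1 with hR
    have hR1 : 1 ≤ R := le_max_right _ _
    have hRpos : 0 < R := by linarith
    have hxR : ‖x₀‖ ≤ R := le_max_left _ _
    rw [fderiv_harmonic_eq_integral_probeBump hHarm hRpos x₀ e]
    -- split `H = P − N` inside the probe
    have hχ1 : ContDiff ℝ 1 (probeBump (E := EuclideanSpace ℝ (Fin 3)) R) := contDiff_probeBump R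
    have hχc := hasCompactSupport_probeBump (E := EuclideanSpace ℝ (Fin 3)) hRpos
    have hDc : Continuous fun z => fderiv ℝ (probeBump (E := EuclideanSpace ℝ (Fin 3)) R) z e :=
      (hχ1.continuous_fderiv one_ne_zero).clm_apply continuous_const
    have hDs : HasCompactSupport fun z => fderiv ℝ (probeBump (E := EuclideanSpace ℝ (Fin 3)) R) z e :=
      hχc.fderiv_apply (𝕜 := ℝ) e
    have hsubc : Continuous fun z : EuclideanSpace ℝ (Fin 3) => x₀ - z := continuous_const.sub continuous_id
    have iP : Integrable fun z => fderiv ℝ (probeBump R) z e * P (x₀ - z) :=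
      (hDc.mul (hPs.continuous.comp hsubc)).integrable_of_hasCompactSupport hDs.mul_right
    have iN : Integrable fun z => fderiv ℝ (probeBump R) z e * N (x₀ - z) :=
      (hDc.mul (hN.continuous.comp hsubc)).integrable_of_hasCompactSupport hDs.mul_right
    have hsplit : ∫ z, fderiv ℝ (probeBump R) z e * H (x₀ - z) =
        (∫ z, fderiv ℝ (probeBump R) z e * P (x₀ - z)) - ∫ z, fderiv ℝ (probeBump R) z e * N (x₀ - z) := by
      rw [← integral_sub iP iN]
      refine integral_congr_ae (Eventually.of_forall fun z => ?_)
      show fderiv ℝ (probeBump R) z e * (P (x₀ - z) - N (x₀ - z)) = _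
      ring
    rw [hsplit, integral_fderiv_mul_comp_sub hχ1 hχc hP1 x₀ e]
    have h1 := hCP x₀ e R hR1 hxR
    have h2 := hCN x₀ e R hR1
    have h3 := abs_sub (∫ z, probeBump R z * fderiv ℝ P (x₀ - z) e) (∫ z, fderiv ℝ (probeBump R) z e * N (x₀ - z))
    linarith
  -- the gradient as a bounded harmonic map
  haveI : CompleteSpace (EuclideanSpace ℝ (Fin 3)) := FiniteDimensional.complete ℝ _
  have hG2 : ContDiff ℝ 2 (gradient H) := by
    have e1 : gradient H = fun z => (InnerProductSpace.toDual ℝ (EuclideanSpace ℝ (Fin 3))).symm (fderiv ℝ H z) := rfl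
    rw [e1]
    exact (InnerProductSpace.toDual ℝ (EuclideanSpace ℝ (Fin 3))).symm.toContinuousLinearEquiv.contDiff.comp
      (hH3.fderiv_right (m := 2) (by norm_cast))
  have hΔG : Δ (gradient H) = 0 := by
    funext z
    rw [laplacian_gradient hH3 z, hΔH]
    simp [Pi.zero_def]
  have hGharm : HarmonicOnNhd (gradient H) univ := fun z _ => ⟨hG2.contDiffAt, by rw [hΔG]⟩
  have hGbd : ∃ C, ∀ x, ‖gradient H x‖ ≤ C := by
    refine ⟨CP + CN, fun x => ?_⟩
    have e1 : ‖gradient H x‖ = ‖fderiv ℝ H x‖ := by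
      unfold gradient
      exact (InnerProductSpace.toDual ℝ (EuclideanSpace ℝ (Fin 3))).symm.norm_map _
    rw [e1]
    refine ContinuousLinearMap.opNorm_le_bound _ (by positivity) fun e => ?_
    rw [Real.norm_eq_abs]
    exact hgrad x e
  have hconst := isConst_of_harmonic_bounded_inner hGharm hGbd
  -- integrate: `H y = H 0 + ⟪∇H(0), y⟫`
  set ℓ : EuclideanSpace ℝ (Fin 3) := gradient H 0 with hℓ
  have hDH : ∀ z, fderiv ℝ H z = (innerSL ℝ ℓ : EuclideanSpace ℝ (Fin 3) →L[ℝ] ℝ) := fun z => by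
    have h1 : fderiv ℝ H z = (InnerProductSpace.toDual ℝ (EuclideanSpace ℝ (Fin 3))) (gradient H z) := by
      simp [gradient]
    rw [h1, hconst z 0, ← hℓ]
    ext v
    simp [InnerProductSpace.toDual_apply_apply]
  set G : EuclideanSpace ℝ (Fin 3) → ℝ := fun y => H y - ⟪ℓ, y⟫ with hG
  have hGd : Differentiable ℝ G :=
    (hH2.differentiable (by norm_num)).sub ((innerSL ℝ ℓ).differentiable)
  have hGD : ∀ z, fderiv ℝ G z = 0 := fun z => by
    have hlin : (inner ℝ ℓ : EuclideanSpace ℝ (Fin 3) → ℝ) = innerSL ℝ ℓ := by funext y; simp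
    have hlin' : (fun y : EuclideanSpace ℝ (Fin 3) => ⟪ℓ, y⟫) = innerSL ℝ ℓ := by funext y; simp
    have hdl : DifferentiableAt ℝ (fun y : EuclideanSpace ℝ (Fin 3) => ⟪ℓ, y⟫) z := by
      rw [hlin']; exact (innerSL ℝ ℓ).differentiableAt
    rw [hG, fderiv_fun_sub ((hH2.differentiable (by norm_num)) z) hdl, hDH z, hlin, ContinuousLinearMap.fderiv,
      sub_self]
  have hGc := is_const_of_fderiv_eq_zero hGd hGD
  refine ⟨ℓ, H 0, fun y => ?_⟩
  have h := hGc y 0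
  simp only [hG, inner_zero_right, sub_zero] at h
  -- `h : H y - ⟪ℓ, y⟫ = H 0`
  have e : P y = N y + H y := by simp [hH]
  rw [e]
  linarith

end Affine

end LocalEnergyRescue

/-! ## §6 S1 reduced to the Riesz pressure -/

open LocalEnergyRescue Literature.Analysis.FluidPDE in
/-- **S1 `stub_driftNormalForm` of the line `local_energy_rescue`, REDUCED to the existence of a `BMO₂` Riesz pressure.**
If the pressure `P` of a bounded smooth rotated profile admits a smooth `N` with `ΔN = ΔP` and bounded mean oscillation
(the Calderón–Zygmund content of KNSS 2009 §5 / Seregin 2014 L.6.5: `N = −RᵢRⱼ(UᵢUⱼ)`), then the conclusion of S1 holds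
verbatim (with the skeleton's `E3` spelled out): some recentring `U(· + y₀) − b` solves the same system with a `BMO₂` pressure.
Proof: `P − N` is affine (`exists_affine_of_rieszPressure`); recentre with `(aI + B)b = −ℓ`, `ay₀ − By₀ = −b`; the recentred
pressure is `P(· + y₀) + ⟪ab + Bb, ·⟫ = N(· + y₀) + const`.  S1 itself, `NoCoRotatingCore` and NS regularity are NOT proved.
[cite: KochNadirashviliSereginSverak2009, §5; Seregin2014, Lemma 6.5 and Remark 6.3] -/
theorem driftNormalForm_of_rieszPressure :
    ∀ (ν a : ℝ), 0 < ν → 0 < a → ∀ (B : EuclideanSpace ℝ (Fin 3) →L[ℝ] EuclideanSpace ℝ (Fin 3))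
      (U : EuclideanSpace ℝ (Fin 3) → EuclideanSpace ℝ (Fin 3)) (P : EuclideanSpace ℝ (Fin 3) → ℝ),
      ContDiff ℝ (⊤ : ℕ∞) U → ContDiff ℝ 2 P → (∀ x, inner ℝ (B x) x = 0) →
      Literature.Analysis.FluidPDE.VectorCalculus.IsDivFree U →
      (∀ y, -(ν • Laplacian.laplacian U y) + a • U y + a • fderiv ℝ U y y
        + (B (U y) - fderiv ℝ U y (B y)) + Literature.Analysis.FluidPDE.convect U U y
        + gradient P y = 0) →
      (∃ M : ℝ, ∀ y, ‖U y‖ ≤ M) →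
      (∃ (N : EuclideanSpace ℝ (Fin 3) → ℝ) (K : ℝ), ContDiff ℝ (⊤ : ℕ∞) N ∧
        (∀ y, Laplacian.laplacian N y = Laplacian.laplacian P y) ∧
        ∀ (z : EuclideanSpace ℝ (Fin 3)) (ρ : ℝ), 0 < ρ →
          ∃ m : ℝ, ∫ y in Metric.ball z ρ, (N y - m) ^ 2 ≤ K * ρ ^ 3) →
      ∃ (y₀ b : EuclideanSpace ℝ (Fin 3)) (P' : EuclideanSpace ℝ (Fin 3) → ℝ) (K : ℝ),
        ContDiff ℝ (⊤ : ℕ∞) (fun y => U (y + y₀) - b) ∧ ContDiff ℝ 2 P' ∧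
        Literature.Analysis.FluidPDE.VectorCalculus.IsDivFree (fun y => U (y + y₀) - b) ∧
        (∀ y, -(ν • Laplacian.laplacian (fun y => U (y + y₀) - b) y) + a • (fun y => U (y + y₀) - b) y
          + a • fderiv ℝ (fun y => U (y + y₀) - b) y y
          + (B ((fun y => U (y + y₀) - b) y) - fderiv ℝ (fun y => U (y + y₀) - b) y (B y))
          + Literature.Analysis.FluidPDE.convect (fun y => U (y + y₀) - b) (fun y => U (y + y₀) - b) y
          + gradient P' y = 0) ∧
        (∃ M' : ℝ, ∀ y, ‖(fun y => U (y + y₀) - b) y‖ ≤ M') ∧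
        (∀ (z : EuclideanSpace ℝ (Fin 3)) (ρ : ℝ), 0 < ρ →
          ∃ m : ℝ, ∫ y in Metric.ball z ρ, (P' y - m) ^ 2 ≤ K * ρ ^ 3) := by
  intro ν a hν ha B U P hU hP hB hdiv heq hbdd hN
  obtain ⟨M, hM⟩ := hbdd
  obtain ⟨N, K, hNs, hΔN, hK⟩ := hN
  obtain ⟨ℓ, c₀, hPform⟩ := exists_affine_of_rieszPressure hν ha hU hP hB hdiv heq hM hNs hΔN hK
  -- the recentring
  obtain ⟨b, hb⟩ := FarFieldLimit.exists_add_clm_apply_eq_of_skew hB ha.ne' (-ℓ)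
  obtain ⟨y₀, hy₀⟩ := exists_recentre hB ha.ne' (-b)
  refine ⟨y₀, b, fun w => P (w + y₀) + ⟪a • b + B b, w⟫, K, ?_, ?_, ?_, ?_, ⟨M + ‖b‖, fun y => ?_⟩, ?_⟩
  · exact (hU.comp (contDiff_id.add contDiff_const)).sub contDiff_const
  · exact (hP.comp (contDiff_id.add contDiff_const)).add (contDiff_const.inner ℝ contDiff_id)
  · intro y
    unfold VectorCalculus.divergence
    rw [fderiv_sub_const, fderiv_comp_add_right]
    exact hdiv (y + y₀)
  · intro y
    have hUs : ContDiff ℝ 2 U := hU.of_le (by norm_cast)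
    have hΔ : Laplacian.laplacian (fun y => U (y + y₀) - b) y = Laplacian.laplacian U (y + y₀) := by
      have hsplit : (fun y => U (y + y₀) - b) = (fun y => U (y + y₀)) - fun _ => b := by
        funext w; simp
      have h1 : ContDiffAt ℝ 2 (fun y => U (y + y₀)) y :=
        (hUs.comp (contDiff_id.add contDiff_const)).contDiffAt
      have h2 : ContDiffAt ℝ 2 (fun _ : EuclideanSpace ℝ (Fin 3) => b) y := contDiffAt_const
      rw [hsplit, h1.laplacian_sub h2, laplacian_comp_add_const]
      simp
    have hfd : fderiv ℝ (fun y => U (y + y₀) - b) y = fderiv ℝ U (y + y₀) := by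
      rw [fderiv_sub_const, fderiv_comp_add_right]
    have hgr : gradient (fun w => P (w + y₀) + ⟪a • b + B b, w⟫) y = gradient P (y + y₀) + (a • b + B b) :=
      gradient_translate_add_inner (hP.of_le (by norm_num)) y₀ (a • b + B b) y
    rw [hΔ, convect_apply, hfd, hgr]
    have key : -(ν • Laplacian.laplacian U (y + y₀)) + a • (U (y + y₀) - b)
        + a • fderiv ℝ U (y + y₀) y
        + (B (U (y + y₀) - b) - fderiv ℝ U (y + y₀) (B y))
        + fderiv ℝ U (y + y₀) (U (y + y₀) - b) + (gradient P (y + y₀) + (a • b + B b))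
        = (-(ν • Laplacian.laplacian U (y + y₀)) + a • U (y + y₀) + a • fderiv ℝ U (y + y₀) (y + y₀)
          + (B (U (y + y₀)) - fderiv ℝ U (y + y₀) (B (y + y₀)))
          + Literature.Analysis.FluidPDE.convect U U (y + y₀) + gradient P (y + y₀))
          - fderiv ℝ U (y + y₀) (a • y₀ - B y₀ + b) := by
      simp only [convect_apply, map_add, map_sub, map_smul, smul_sub, smul_add]
      abel
    rw [key, heq (y + y₀), hy₀, neg_add_cancel, map_zero, sub_zero]
  · calc ‖U (y + y₀) - b‖ ≤ ‖U (y + y₀)‖ + ‖b‖ := norm_sub_le _ _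
      _ ≤ M + ‖b‖ := by linarith [hM (y + y₀)]
  · -- `BMO₂` of the recentred pressure `P' = N(· + y₀) + const`
    intro z ρ hρ
    obtain ⟨m, hm⟩ := hK (z + y₀) ρ hρ
    refine ⟨m + (c₀ + ⟪ℓ, y₀⟫), ?_⟩
    have hpt : ∀ y, (P (y + y₀) + ⟪a • b + B b, y⟫ - (m + (c₀ + ⟪ℓ, y₀⟫))) ^ 2 = (N (y + y₀) - m) ^ 2 := by
      intro y
      rw [hPform (y + y₀), hb, inner_add_right, inner_neg_left]
      ring
    simp_rw [hpt]
    rw [setIntegral_ball_comp_add (fun w => (N w - m) ^ 2) z y₀ ρ]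
    exact hm


end Summit.NavierStokesRegularity.NavierStokesRegularity.Theorems.CoriolisHead

end
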